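import Mathlib

/-!
# Route `DiophantineDichotomy`, crux `KhovanskiiApproxTypeEv`, line `Sketch`:
# stub `stub_finrankAdjoinRangeLe` — the field degree of a tuple of algebraic numbers

Crux `Summit.Schanuel.Schanuel.Theses.DiophantineDichotomy.KhovanskiiApproxTypeEv`
(item stmt-Schanuel-14972), registered stub `stub_finrankAdjoinRangeLe` (`--supports`), the generic
bookkeeping of the pair-sum hardness certificate: if each `zᵢ` (`i` ranging over a finite type) is a
root of a non-zero integer polynomial of degree `≤ mᵢ`, then `[ℚ(z₁, …, z_r) : ℚ] ≤ ∏ᵢ mᵢ`.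

Proof.  One generator: `[ℚ(z):ℚ] = deg (minpoly ℚ z) ≤ deg P ≤ m`
(`IntermediateField.adjoin.finrank`, `minpoly.degree_le_of_ne_zero`).  Several generators: induction
over a `Finset`, with `ℚ(insert x S) = ℚ⟮x⟯ ⊔ ℚ(S)` (`IntermediateField.adjoin_union`) and
`[E₁ ⊔ E₂ : ℚ] ≤ [E₁ : ℚ] [E₂ : ℚ]` (`IntermediateField.finrank_sup_le`); then `T = univ`.
-/

noncomputable section

-- mandated summit/sub-problem namespace (single-conjunct summit)
set_option linter.dupNamespace false

namespace Summit.Schanuel.Schanuel.Cruxes.KhovanskiiApproxTypeEv.AnchoredReduction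

open scoped IntermediateField
open Polynomial

/-- One generator: a root `z` of a non-zero integer polynomial of degree `≤ n` generates a field
of degree `[ℚ(z):ℚ] ≤ n`. [folklore] -/
theorem finrank_adjoin_simple_le_of_intPoly {z : ℂ} {n : ℕ}
    (h : ∃ P : Polynomial ℤ, P ≠ 0 ∧ P.natDegree ≤ n ∧ Polynomial.aeval z P = 0) :
    Module.finrank ℚ ↥ℚ⟮z⟯ ≤ n := by
  -- adapted from `finrank_adjoin_simple_le_of_clause`
  -- (Summits/Schanuel/Schanuel/Theorems/EPiSimultaneousType/Negative/CoordinatewiseLinear.lean)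
  obtain ⟨P, hP0, hdeg, hroot⟩ := h
  set Q : ℚ[X] := P.map (algebraMap ℤ ℚ) with hQ
  have hQ0 : Q ≠ 0 := (Polynomial.map_ne_zero_iff (algebraMap ℤ ℚ).injective_int).mpr hP0
  have hQroot : Polynomial.aeval z Q = 0 := by
    rw [hQ, Polynomial.aeval_map_algebraMap]; exact hroot
  have hint : IsIntegral ℚ z := isAlgebraic_iff_isIntegral.mp ⟨Q, hQ0, hQroot⟩
  rw [IntermediateField.adjoin.finrank hint]
  calc (minpoly ℚ z).natDegree ≤ Q.natDegree :=
        Polynomial.natDegree_le_natDegree (minpoly.degree_le_of_ne_zero ℚ z hQ0 hQroot)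
    _ = P.natDegree := Polynomial.natDegree_map_eq_of_injective (algebraMap ℤ ℚ).injective_int P
    _ ≤ n := hdeg

/-- Finitely many generators indexed by a `Finset`: `[ℚ(z(T)):ℚ] ≤ ∏_{i ∈ T} mᵢ` when each `zᵢ` is a
root of a non-zero integer polynomial of degree `≤ mᵢ`. [folklore] -/
theorem finrank_adjoin_image_finset_le {ι : Type*} (z : ι → ℂ) (m : ι → ℕ)
    (h : ∀ i, ∃ P : Polynomial ℤ, P ≠ 0 ∧ P.natDegree ≤ m i ∧ Polynomial.aeval (z i) P = 0)
    (T : Finset ι) :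
    Module.finrank ℚ ↥(IntermediateField.adjoin ℚ (z '' ↑T)) ≤ ∏ i ∈ T, m i := by
  classical
  induction T using Finset.induction_on with
  | empty =>
    rw [Finset.coe_empty, Set.image_empty, IntermediateField.adjoin_empty,
      IntermediateField.finrank_bot, Finset.prod_empty]
  | insert i T hi ih =>
    rw [Finset.coe_insert, Set.image_insert_eq, Set.insert_eq, IntermediateField.adjoin_union,
      Finset.prod_insert hi]
    exact (IntermediateField.finrank_sup_le _ _).trans
      (Nat.mul_le_mul (finrank_adjoin_simple_le_of_intPoly (h i)) ih)

/-- **Field degree of a tuple.** If `z : ι → ℂ` (`ι` finite) and each `zᵢ` is a root of a non-zero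
integer polynomial of degree `≤ mᵢ`, then `[ℚ(z₁, …, z_r):ℚ] ≤ ∏ᵢ mᵢ`. [folklore] -/
theorem stub_finrankAdjoinRangeLe {ι : Type*} [Fintype ι] (z : ι → ℂ) (m : ι → ℕ)
    (h : ∀ i, ∃ P : Polynomial ℤ, P ≠ 0 ∧ P.natDegree ≤ m i ∧ Polynomial.aeval (z i) P = 0) :
    Module.finrank ℚ ↥(IntermediateField.adjoin ℚ (Set.range z)) ≤ ∏ i, m i := by
  have key := finrank_adjoin_image_finset_le z m h Finset.univ
  rwa [Finset.coe_univ, Set.image_univ] at key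

end Summit.Schanuel.Schanuel.Cruxes.KhovanskiiApproxTypeEv.AnchoredReduction

end
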